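/-
Copyright (c) 2026 the pub-hodgecm-mathlib formalisation cell (harness21).  Prover seat hodgecm-mathlib-LH4-p16 (g0), req620 Track A «(D-RAM) FOUR-FRAME» squad
(STAGE-1b, row (2) of the piece `f_{T₊}`, the (β₂) road under heir LEAD F0P3a-plan (g21) T20-18 (R-36) «PURE-CELL LEDGER»; row (L-K0) holder; M-letter bridge agreed with
LH4-p15 (g0) 15:21:40Z «one holder»; β₂-board sub-dealer LH4-p04 (g8) BETA2-BOARD v1 da0f832c §0), 2026-09-04.
-/
import Summits.HodgeConjecture.HodgeConjecture.Theorems.F0P3cDyRamGlueValueDepthForm      -- ★ p861311 (this seat): «THE DEPTH-FORM LETTER» `valueSet_endoGL_sub_one_glued_eq_depthSet_of_v_sub_one_le`; brings ★ p860233 §5 `map_pairing_sub_smul_one_mulVec_eq_trace`, ★ census DEFS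
import Summits.HodgeConjecture.HodgeConjecture.Theorems.F0P3cDyRamConeGlueNormTransport    -- ★ p857402 (LH4-p12 (g4)): `exists_coneData_of_gen` (`φ w₀ = Y⁻¹x₀`), `herm_inv_mul_self_eq`; brings ★ DEFS leaf `F0P3cDyRamToricCensusDefs` (`IsOrd`, `dualGen`)
import HarnessLib

/-!
# Crux `H413`, line LH4 «(D-RAM) FOUR-FRAME» — STAGE-1b, row (2), the (β₂) road (R-36): «THE DEPTH-FORM LETTER IN THE LINE MODEL» — under `|u₀₀ − 1| ≤ |ϖ^m|` the census
# letter of the self-dual vertex over `Λ = x₀·𝒪_j` is the `ϖ^m`-value set of ONE scalar multiple of the hermitian norm form on the dual lattice: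
# `{z ∣ ∃ ζ ∈ 𝒪_j, ∃ |a| ≤ 1, |(jEϖ^m)⁻¹(jE z − Tr_ρ( (lam − jE u₀₀)·N_Θ(Y·ζ + jE a) ∕ (ϖE^j(α − ρα)·ΘY) ))| ≤ 1}`, `Y = dualGen x₀`

Cell `hodgecm-mathlib` (D-0151), FLOOR 0, crux item H413 = `stmt-HodgeConjecture-24833`, route of record `HCCMUnconditional`; squad F0∕P3c∕LH4; lane
`--supports stmt-HodgeConjecture-24833 --as helper` (count-neutral; pays NO tier-0 row).  THEOREMS ONLY (no `def`, no instance, no notation, no `sorry`, default heartbeats);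
★-only imports; states NO law; (β₂) stays a HYPOTHESIS.  DATUM-FREE: the plane `(E², H₂)` with `σ` (any ring endomorphism), `|ϖ| = exp(−1)`, block form `H = block(H₂, h)`,
`Γ = endoGL (γ₂, u)`; the LINE MODEL `(M, jE, ρ, Θ; φ, lam, h_M)` of `(H₂, γ₂)` in ★ (C1)'s letters (`hφs hφγ hform hjv`); no residue field, no `|2|`.

WHY (BETA2-BOARD v1 §0; ★ p861311 «DEPTH-FORM LETTER»; LH4-p15 (g0) 15:20:37Z CONSEQUENCE paragraph; LH4-cdis1 (g0) LAM1CHECK «=» 15:19:17Z).  ★ p861311 shows that under the board's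
`hum : |u₀₀ − 1| ≤ |ϖ^m|` the letter of an integral glued vertex `L` over the plane data `(B₂, w₀)` is the `ϖ^m`-value set of the DEPTH FORM `β′ ↦ ⟨β′, (γ₂ − u₀₀)β′⟩_{H₂}` on
`B₂ + 𝒪·w₀`.  The pure-cell rows ((L-D) LH7-p10, (L-S1∕S2) LH4-p15, (L-K0) this seat) and the balanced rows ((L-P) LH7-p09) count over the cone cells `levelSetDep(j, b; lam − jE u₀₀)`
of the LINE MODEL, where `Λ = φ(B₂) = x₀·𝒪_j` and `φ w₀ = Y⁻¹x₀`, `Y = dualGen ρ Θ α (ϖE^j) h_M x₀` (★ `exists_coneData_of_gen`).  THIS FILE pushes the depth form through `jE`: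
* §1 `v_thicken_iff_map` — the `ϖ^m`-thickening commutes with `jE` (`|jE c| ≤ 1 ↔ |c| ≤ 1`); `depthSet_eq_lineModelSet` — the depth set in M-letters:
  `{z ∣ ∃ β ∈ B₂, ∃ |a| ≤ 1, |(jEϖ^m)⁻¹(jE z − T(φ(β + a·w₀)))| ≤ 1}`, `T x := h_M·Θx·((lam − jE c)·x) + ρ(…)` (★ p860233 §5 `map_pairing_sub_smul_one_mulVec_eq_trace`).
* §2 HEAD A `valueSet_endoGL_sub_one_glued_eq_lineModelSet_of_v_sub_one_le` — ★ p861311 ∘ §1: the letter of an integral glued vertex under `hum`, general block form `(H₂, h)` (the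
  `VS_H` of BETA2-BOARD §0), in M-letters.
* §3 HEAD B `valueSet_endoGL_sub_one_glued_eq_normFormSet_of_gen` — GENERATOR FORM over the presentation `Λ = x₀·𝒪_j` (`hBΛ : φ(B₂) = Λ`, `hΛx`, `hw₀Y : φ w₀ = Y⁻¹x₀`):
  `φ(β + a·w₀) = Y⁻¹x₀·(Y·ζ + jE a)` and `T(Y⁻¹x₀·η) = Tr_ρ((lam − jE u₀₀)·N_Θ(η) ∕ (ϖE^j(α − ρα)·ΘY))` (`Y = h_M·N_Θ(x₀)·ϖE^j(α − ρα)`, ★ DEFS `dualGen_def`), so the letter is the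
  `ϖ^m`-value set of the ONE-SCALAR norm form `η ↦ Tr_ρ(c_Λ·N_Θ η)`, `c_Λ := (lam − jE u₀₀) ∕ (ϖE^j(α − ρα)·ΘY)`, on `η ∈ Y·𝒪_j + 𝒪_E` (= `𝒪_j`: ★ DEFS `forall_mem_herm_iff_exists`;
  not needed here).  The literal enters through `h_M` only via `Y` (hence via `c_Λ`); a flip `x₀ ↦ ε·x₀` (`ε·Θε = ξ ∈ F`) sends `Y ↦ ξ·Y`, `c_Λ ↦ c_Λ∕ξ`.
WHAT THE ROWS DO WITH IT (not here): PURE cell = «the class of `thick_m Tr_ρ(c_Λ·N_Θ(Y𝒪_j + 𝒪_E))` is constant along the cell»; BALANCED cell = a cell symmetry moving `c_Λ` by a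
non-norm; the `a = 1, ζ = 0` value `Tr_ρ(c_Λ)` is `jE⟨w₀, (γ₂ − u₀₀)w₀⟩` (the depth scalar, integral by the cone condition `(γ₂ − u₀₀)w₀ ∈ B₂`).
HONEST LABEL.  Count-neutral lattice algebra; nothing printed is asserted; no census law is stated; `HC_CM` is proved only modulo the 7 printed citations (2 remaining named inputs:
hLiu418 = `stmt-HodgeConjecture-24832`, h413 = `stmt-HodgeConjecture-24833`) until rung 0 closes.
## References
* [Jacobowitz1962] R. Jacobowitz, *Hermitian forms over local fields*, Amer. J. Math. 84 (1962): §4 (dual lattices, gluing; hermitian lines over the quadratic extension).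
* [Flicker1998UnitaryFL] Y. Z. Flicker, *Elementary proof of the fundamental lemma for a unitary group*, Canad. J. Math. 50 (1998): p. 84 REMARK (the elliptic plane as a line).
* [Rogawski1990] J. D. Rogawski, *Automorphic Representations of Unitary Groups in Three Variables*, Ann. of Math. Stud. 123 (1990): §4.9 Prop. 4.9.1 (b) p. 55.
* [Kottwitz1986BaseChangeUnits] R. E. Kottwitz, *Base change for unit elements of Hecke algebras*, Compositio Math. 60 (1986): §1 pp. 240–241.
-/

set_option autoImplicit false

noncomputable section

namespace Summit.HodgeConjecture.HodgeConjecture.Cruxes.H413.F0P3cDyRamDepthFormLineModel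

open scoped Valued WithZero Matrix MatrixGroups
open WithZero
open Literature.NumberTheory.Automorphic Literature.NumberTheory.Automorphic.HermitianLattice Literature.NumberTheory.Automorphic.UnitaryLatticeTree
open Literature.NumberTheory.Rogawski1990
open Summit.HodgeConjecture.HodgeConjecture.Cruxes.H413.F0P3cDyRamToricCensusDefs
open Summit.HodgeConjecture.HodgeConjecture.Cruxes.H413.F0P3cDyRamBlockGlueValueSet
open Summit.HodgeConjecture.HodgeConjecture.Cruxes.H413.F0P3cDyRamGlueValueDepthForm
open Summit.HodgeConjecture.HodgeConjecture.Cruxes.H413.F0P3cDyRamConeLevelTransport (herm_inv_mul_self_eq)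

variable {E M : Type*} [Field E] [Valued E ℤᵐ⁰] [Field M] [Valued M ℤᵐ⁰] {ρ Θ : M →+* M} {α : M}

/-! ## §1 The depth set in M-letters -/

omit [Valued M ℤᵐ⁰] in
/-- **`jE` COMMUTES WITH THE `ϖ^m`-THICKENING**: `|(ϖ^m)⁻¹(z − D)| ≤ 1 ↔ |(jE ϖ^m)⁻¹(jE z − jE D)| ≤ 1` for `|jE c| ≤ 1 ↔ |c| ≤ 1`. [cite: Jacobowitz1962, §4] -/
theorem v_thicken_iff_map [Valued M ℤᵐ⁰] (jE : E →+* M) (hjv : ∀ c, Valued.v (jE c) ≤ 1 ↔ Valued.v c ≤ 1) (ϖ : E) (m : ℕ) (z D : E) :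
    Valued.v ((ϖ ^ m)⁻¹ * (z - D)) ≤ 1 ↔ Valued.v ((jE ϖ ^ m)⁻¹ * (jE z - jE D)) ≤ 1 := by
  rw [← hjv, map_mul, map_inv₀, map_pow, map_sub]

/-- **THE DEPTH SET IN M-LETTERS.**  In ★ (C1)'s line model of `(H₂, γ₂)` (`φ` `jE`-semilinear, `φ(γ₂x) = lam·φx`, `jE⟨x, y⟩_{H₂} = h_M·Θ(φx)·φy + ρ(…)`, `|jE c| ≤ 1 ↔ |c| ≤ 1`):
the `ϖ^m`-thickened set of depth values `⟨β′, (γ₂ − c)β′⟩_{H₂}`, `β′ = β + a·w₀`, is `{z ∣ ∃ β ∈ B₂, ∃ |a| ≤ 1, |(jEϖ^m)⁻¹(jE z − T(φ(β + a·w₀)))| ≤ 1}` with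
`T x = h_M·Θx·((lam − jE c)·x) + ρ(h_M·Θx·((lam − jE c)·x))` (★ p860233 §5). [cite: Jacobowitz1962, §4] [cite: Flicker1998UnitaryFL, p. 84 REMARK] -/
theorem depthSet_eq_lineModelSet (σ : E →+* E) (H₂ : Matrix (Fin 2) (Fin 2) E) (jE : E →+* M) (hjv : ∀ c, Valued.v (jE c) ≤ 1 ↔ Valued.v c ≤ 1)
    (φ : (Fin 2 → E) →+ M) (hφs : ∀ (c : E) (x : Fin 2 → E), φ (c • x) = jE c * φ x)
    {γ₂ : GL (Fin 2) E} {lam hM : M} (hφγ : ∀ x, φ ((γ₂ : Matrix (Fin 2) (Fin 2) E) *ᵥ x) = lam * φ x)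
    (hform : ∀ x y, jE (pairing σ H₂ x y) = hM * Θ (φ x) * φ y + ρ (hM * Θ (φ x) * φ y))
    (c : E) (B₂ : Submodule 𝒪[E] (Fin 2 → E)) (w₀ : Fin 2 → E) (ϖ : E) (m : ℕ) :
    {z : E | ∃ β ∈ B₂, ∃ a : E, Valued.v a ≤ 1 ∧
        Valued.v ((ϖ ^ m)⁻¹ * (z - pairing σ H₂ (β + a • w₀) ((((γ₂ : Matrix (Fin 2) (Fin 2) E) - c • (1 : Matrix (Fin 2) (Fin 2) E))) *ᵥ (β + a • w₀)))) ≤ 1} =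
      {z : E | ∃ β ∈ B₂, ∃ a : E, Valued.v a ≤ 1 ∧
        Valued.v ((jE ϖ ^ m)⁻¹ * (jE z - (hM * Θ (φ (β + a • w₀)) * ((lam - jE c) * φ (β + a • w₀)) +
          ρ (hM * Θ (φ (β + a • w₀)) * ((lam - jE c) * φ (β + a • w₀)))))) ≤ 1} := by
  ext z
  simp only [Set.mem_setOf_eq]
  refine exists_congr fun β => and_congr_right fun _ => exists_congr fun a => and_congr_right fun _ => ?_
  rw [v_thicken_iff_map jE hjv, map_pairing_sub_smul_one_mulVec_eq_trace σ H₂ jE ρ Θ φ hφs hφγ hform c]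

/-! ## §2 HEAD A — the letter of an integral glued vertex under `|u₀₀ − 1| ≤ |ϖ^m|`, in M-letters -/

/-- **HEAD A — «THE DEPTH-FORM LETTER IN THE LINE MODEL» (general block form `(H₂, h)`).**  ★ p860233's glue letters for an INTEGRAL vertex `L` over `(B₂, w₀)` with 3-space
generator `g₀` (`hpr hB hg₀ hg₀1 hprg`, `hint`), `|u₀₀ − 1| ≤ |ϖ^m|`, and ★ (C1)'s line model: the `ϖ^m`-value set of `Γ − 1` on `L` is
`{z ∣ ∃ β ∈ B₂, ∃ |a| ≤ 1, |(jEϖ^m)⁻¹(jE z − T(φ(β + a·w₀)))| ≤ 1}`, `T x = h_M·Θx·((lam − jE u₀₀)·x) + ρ(…)` (★ p861311 ∘ §1).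
[cite: Jacobowitz1962, §4] [cite: Rogawski1990, §4.9 Prop. 4.9.1 (b) p. 55] [cite: Kottwitz1986BaseChangeUnits, §1 pp. 240–241] -/
theorem valueSet_endoGL_sub_one_glued_eq_lineModelSet_of_v_sub_one_le (σ : E →+* E) {ϖ : E} (hϖ : Valued.v ϖ = exp (-1 : ℤ)) (H₂ : Matrix (Fin 2) (Fin 2) E) (h : E)
    (jE : E →+* M) (hjv : ∀ c, Valued.v (jE c) ≤ 1 ↔ Valued.v c ≤ 1)
    (φ : (Fin 2 → E) →+ M) (hφs : ∀ (c : E) (x : Fin 2 → E), φ (c • x) = jE c * φ x)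
    {γ₂ : GL (Fin 2) E} {lam hM : M} (hφγ : ∀ x, φ ((γ₂ : Matrix (Fin 2) (Fin 2) E) *ᵥ x) = lam * φ x)
    (hform : ∀ x y, jE (pairing σ H₂ x y) = hM * Θ (φ x) * φ y + ρ (hM * Θ (φ x) * φ y))
    {L : Submodule 𝒪[E] (Fin 3 → E)} {b : ℕ} (hpr : ∀ x ∈ L, Valued.v (x 1) * Valued.v ϖ ^ b ≤ 1)
    (hint : ∀ y ∈ L, Valued.v (pairing σ (!![H₂ 0 0, 0, H₂ 0 1; 0, h, 0; H₂ 1 0, 0, H₂ 1 1] : Matrix (Fin 3) (Fin 3) E) y y) ≤ 1)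
    {B₂ : Submodule 𝒪[E] (Fin 2 → E)} {w₀ : Fin 2 → E} {g₀ : Fin 3 → E}
    (hB : B₂.map ((Matrix.toLin' (!![1, 0; 0, 0; 0, 1] : Matrix (Fin 3) (Fin 2) E)).restrictScalars 𝒪[E]) =
      L ⊓ LinearMap.ker ((LinearMap.proj (1 : Fin 3) : (Fin 3 → E) →ₗ[E] E).restrictScalars 𝒪[E]))
    (hg₀ : g₀ ∈ L) (hg₀1 : Valued.v (g₀ 1) * Valued.v ϖ ^ b = 1) (hprg : g₀ - Pi.single 1 (g₀ 1) = ![w₀ 0, 0, w₀ 1])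
    (u : GL (Fin 1) E) (m : ℕ) (hum : Valued.v ((u : Matrix (Fin 1) (Fin 1) E) 0 0 - 1) ≤ Valued.v (ϖ ^ m)) :
    {z : E | ∃ y ∈ L, Valued.v ((ϖ ^ m)⁻¹ * (z - pairing σ (!![H₂ 0 0, 0, H₂ 0 1; 0, h, 0; H₂ 1 0, 0, H₂ 1 1] : Matrix (Fin 3) (Fin 3) E) y
        ((((endoGL (γ₂, u) : GL (Fin 3) E) : Matrix (Fin 3) (Fin 3) E) - 1) *ᵥ y))) ≤ 1} =
      {z : E | ∃ β ∈ B₂, ∃ a : E, Valued.v a ≤ 1 ∧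
        Valued.v ((jE ϖ ^ m)⁻¹ * (jE z - (hM * Θ (φ (β + a • w₀)) * ((lam - jE ((u : Matrix (Fin 1) (Fin 1) E) 0 0)) * φ (β + a • w₀)) +
          ρ (hM * Θ (φ (β + a • w₀)) * ((lam - jE ((u : Matrix (Fin 1) (Fin 1) E) 0 0)) * φ (β + a • w₀)))))) ≤ 1} := by
  rw [valueSet_endoGL_sub_one_glued_eq_depthSet_of_v_sub_one_le σ hϖ H₂ h hpr hint hB hg₀ hg₀1 hprg γ₂ u m hum]
  exact depthSet_eq_lineModelSet σ H₂ jE hjv φ hφs hφγ hform _ B₂ w₀ ϖ m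

/-! ## §3 HEAD B — generator form over the presentation `Λ = x₀·𝒪_j`, `φ w₀ = Y⁻¹x₀` -/

omit [Valued E ℤᵐ⁰] [Valued M ℤᵐ⁰] in
/-- **THE NORM FORM OF THE DUAL GENERATOR**: for `Y = dualGen ρ Θ α cc h_M x₀ = h_M·(x₀Θx₀)·(cc(α − ρα))` (all factors non-zero) and any `η`,
`h_M·Θ(Y⁻¹x₀·η)·(μ·(Y⁻¹x₀·η)) = μ·(η·Θη) ∕ (cc(α − ρα)·ΘY)`. [cite: Jacobowitz1962, §4] -/
theorem herm_dualGenInv_mul_eq (hΘΘ : ∀ x, Θ (Θ x) = x) {cc hM x₀ : M} (hcc : cc * (α - ρ α) ≠ 0) (hhM : hM ≠ 0) (hx₀ : x₀ ≠ 0) (μ η : M) :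
    hM * Θ ((dualGen ρ Θ α cc hM x₀)⁻¹ * x₀ * η) * (μ * ((dualGen ρ Θ α cc hM x₀)⁻¹ * x₀ * η)) =
      μ * (η * Θ η) / (cc * (α - ρ α) * Θ (dualGen ρ Θ α cc hM x₀)) := by
  have hΘx₀ : Θ x₀ ≠ 0 := (map_ne_zero Θ).2 hx₀
  have hΘhM : Θ hM ≠ 0 := (map_ne_zero Θ).2 hhM
  have hΘcc : Θ (cc * (α - ρ α)) ≠ 0 := (map_ne_zero Θ).2 hcc
  have hY0 : dualGen ρ Θ α cc hM x₀ ≠ 0 := by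
    rw [dualGen_def]; exact mul_ne_zero (mul_ne_zero hhM (mul_ne_zero hx₀ hΘx₀)) hcc
  have hΘY0 : Θ (dualGen ρ Θ α cc hM x₀) ≠ 0 := (map_ne_zero Θ).2 hY0
  rw [dualGen_def] at hY0 hΘY0 ⊢
  rw [map_mul, map_mul, map_inv₀, map_mul Θ (hM * (x₀ * Θ x₀)), map_mul Θ hM, map_mul Θ x₀, hΘΘ] at *
  field_simp

/-- **HEAD B — «THE LETTER OF THE VERTEX OVER `Λ = x₀·𝒪_j` IS THE VALUE SET OF ONE SCALAR MULTIPLE OF THE NORM FORM».**  HEAD A's frame plus the cell presentation of ★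
`exists_coneData_of_gen` (`hBΛ : φ(B₂) = Λ`, `hΛx : Λ = x₀·{ζ ∣ IsOrd ρ α cc ζ}`, `hw₀Y : φ w₀ = Y⁻¹x₀`, `Y = dualGen ρ Θ α cc h_M x₀`, `cc(α − ρα) ≠ 0`, `h_M, x₀ ≠ 0`,
`Θ` an involution): the `ϖ^m`-value set of `Γ − 1` on `L` is
`{z ∣ ∃ ζ a, IsOrd ρ α cc ζ ∧ |a| ≤ 1 ∧ |(jEϖ^m)⁻¹(jE z − Tr_ρ( (lam − jE u₀₀)·N_Θ(Y·ζ + jE a) ∕ (cc(α − ρα)·ΘY) ))| ≤ 1}` — ONE scalar `c_Λ = (lam − jE u₀₀)∕(cc(α − ρα)·ΘY)` per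
`Λ`, times the hermitian norm form on `Y·𝒪_j + 𝒪_E`.  (For (L-D)∕(L-S1∕S2)∕(L-K0)∕(L-P): the label of the vertex is the class of THIS set; `c_Λ ↦ c_Λ∕ξ` under a flip `x₀ ↦ εx₀`,
`εΘε = ξ`.) [cite: Jacobowitz1962, §4] [cite: Flicker1998UnitaryFL, p. 84 REMARK] [cite: Rogawski1990, §4.9 Prop. 4.9.1 (b) p. 55] [cite: Kottwitz1986BaseChangeUnits, §1 pp. 240–241] -/
theorem valueSet_endoGL_sub_one_glued_eq_normFormSet_of_gen (σ : E →+* E) {ϖ : E} (hϖ : Valued.v ϖ = exp (-1 : ℤ)) (H₂ : Matrix (Fin 2) (Fin 2) E) (h : E)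
    (jE : E →+* M) (hjv : ∀ c, Valued.v (jE c) ≤ 1 ↔ Valued.v c ≤ 1) (hΘΘ : ∀ x, Θ (Θ x) = x)
    (φ : (Fin 2 → E) →+ M) (hφs : ∀ (c : E) (x : Fin 2 → E), φ (c • x) = jE c * φ x)
    {γ₂ : GL (Fin 2) E} {lam hM : M} (hφγ : ∀ x, φ ((γ₂ : Matrix (Fin 2) (Fin 2) E) *ᵥ x) = lam * φ x) (hhM : hM ≠ 0)
    (hform : ∀ x y, jE (pairing σ H₂ x y) = hM * Θ (φ x) * φ y + ρ (hM * Θ (φ x) * φ y))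
    {L : Submodule 𝒪[E] (Fin 3 → E)} {b : ℕ} (hpr : ∀ x ∈ L, Valued.v (x 1) * Valued.v ϖ ^ b ≤ 1)
    (hint : ∀ y ∈ L, Valued.v (pairing σ (!![H₂ 0 0, 0, H₂ 0 1; 0, h, 0; H₂ 1 0, 0, H₂ 1 1] : Matrix (Fin 3) (Fin 3) E) y y) ≤ 1)
    {B₂ : Submodule 𝒪[E] (Fin 2 → E)} {w₀ : Fin 2 → E} {g₀ : Fin 3 → E}
    (hB : B₂.map ((Matrix.toLin' (!![1, 0; 0, 0; 0, 1] : Matrix (Fin 3) (Fin 2) E)).restrictScalars 𝒪[E]) =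
      L ⊓ LinearMap.ker ((LinearMap.proj (1 : Fin 3) : (Fin 3 → E) →ₗ[E] E).restrictScalars 𝒪[E]))
    (hg₀ : g₀ ∈ L) (hg₀1 : Valued.v (g₀ 1) * Valued.v ϖ ^ b = 1) (hprg : g₀ - Pi.single 1 (g₀ 1) = ![w₀ 0, 0, w₀ 1])
    (u : GL (Fin 1) E) (m : ℕ) (hum : Valued.v ((u : Matrix (Fin 1) (Fin 1) E) 0 0 - 1) ≤ Valued.v (ϖ ^ m))
    {cc x₀ : M} (hcc : cc * (α - ρ α) ≠ 0) (hx₀ : x₀ ≠ 0) {Λ : AddSubgroup M} (hBΛ : B₂.toAddSubgroup.map φ = Λ)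
    (hΛx : ∀ x, x ∈ Λ ↔ ∃ ζ, IsOrd ρ α cc ζ ∧ x = x₀ * ζ) (hw₀Y : φ w₀ = (dualGen ρ Θ α cc hM x₀)⁻¹ * x₀) :
    {z : E | ∃ y ∈ L, Valued.v ((ϖ ^ m)⁻¹ * (z - pairing σ (!![H₂ 0 0, 0, H₂ 0 1; 0, h, 0; H₂ 1 0, 0, H₂ 1 1] : Matrix (Fin 3) (Fin 3) E) y
        ((((endoGL (γ₂, u) : GL (Fin 3) E) : Matrix (Fin 3) (Fin 3) E) - 1) *ᵥ y))) ≤ 1} =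
      {z : E | ∃ (ζ : M) (a : E), IsOrd ρ α cc ζ ∧ Valued.v a ≤ 1 ∧
        Valued.v ((jE ϖ ^ m)⁻¹ * (jE z -
          ((lam - jE ((u : Matrix (Fin 1) (Fin 1) E) 0 0)) * ((dualGen ρ Θ α cc hM x₀ * ζ + jE a) * Θ (dualGen ρ Θ α cc hM x₀ * ζ + jE a)) /
              (cc * (α - ρ α) * Θ (dualGen ρ Θ α cc hM x₀)) +
            ρ ((lam - jE ((u : Matrix (Fin 1) (Fin 1) E) 0 0)) * ((dualGen ρ Θ α cc hM x₀ * ζ + jE a) * Θ (dualGen ρ Θ α cc hM x₀ * ζ + jE a)) /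
              (cc * (α - ρ α) * Θ (dualGen ρ Θ α cc hM x₀)))))) ≤ 1} := by
  rw [valueSet_endoGL_sub_one_glued_eq_lineModelSet_of_v_sub_one_le σ hϖ H₂ h jE hjv φ hφs hφγ hform hpr hint hB hg₀ hg₀1 hprg u m hum]
  set Y : M := dualGen ρ Θ α cc hM x₀ with hYdef
  set μ : M := lam - jE ((u : Matrix (Fin 1) (Fin 1) E) 0 0) with hμdef
  have hY0 : Y ≠ 0 := by
    rw [hYdef, dualGen_def]; exact mul_ne_zero (mul_ne_zero hhM (mul_ne_zero hx₀ ((map_ne_zero Θ).2 hx₀))) hcc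
  -- `φ(β + a·w₀) = Y⁻¹·x₀·(Y·ζ + jE a)` when `φ β = x₀·ζ`
  have hφβa : ∀ (β : Fin 2 → E) (a : E) (ζ : M), φ β = x₀ * ζ → φ (β + a • w₀) = Y⁻¹ * x₀ * (Y * ζ + jE a) := fun β a ζ hβ => by
    rw [map_add, hφs, hw₀Y, hβ]
    field_simp
  -- the value at `Y⁻¹x₀·η`
  have hval : ∀ η : M, hM * Θ (Y⁻¹ * x₀ * η) * (μ * (Y⁻¹ * x₀ * η)) = μ * (η * Θ η) / (cc * (α - ρ α) * Θ Y) := fun η =>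
    herm_dualGenInv_mul_eq (ρ := ρ) hΘΘ hcc hhM hx₀ μ η
  ext z
  simp only [Set.mem_setOf_eq]
  constructor
  · rintro ⟨β, hβ, a, ha, hz⟩
    have hφβ : φ β ∈ Λ := by rw [← hBΛ]; exact AddSubgroup.mem_map_of_mem _ hβ
    obtain ⟨ζ, hζ, hβζ⟩ := (hΛx _).1 hφβ
    refine ⟨ζ, a, hζ, ha, ?_⟩
    rwa [hφβa β a ζ hβζ, hval] at hz
  · rintro ⟨ζ, a, hζ, ha, hz⟩
    have hxζ : x₀ * ζ ∈ Λ := (hΛx _).2 ⟨ζ, hζ, rfl⟩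
    rw [← hBΛ, AddSubgroup.mem_map] at hxζ
    obtain ⟨β, hβ, hβζ⟩ := hxζ
    refine ⟨β, hβ, a, ha, ?_⟩
    rwa [hφβa β a ζ hβζ, hval]

end Summit.HodgeConjecture.HodgeConjecture.Cruxes.H413.F0P3cDyRamDepthFormLineModel

end
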